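import Mathlib
import Summits.Ventures.HodgeRepro.Tier4.Common.LocalCoordinatesConj
import Summits.Ventures.HodgeRepro.Tier4.Line4.D3Coeff
import Summits.Ventures.HodgeRepro.Tier4.Line4.D3CoeffUnitary

/-!
# Tier4/Line4/D3CoeffConj — C-L4-D3COEFF on the SEESAW PLANE: the `T′`-adapted weight-3 coefficient `D3coeff'` and its
`T′`-equivariance laws — the `equiv` field of plan-4 g4's `IsArchCoeff` (7′) discharged at `w₀` with the weights
`(eP′ w₀, eM′ w₀) = (3, 0)`

Blind re-derivation cell `pub-hodge-repro`, Tier 4 (README §9–§10), seat t4-L1-p5 (prover, gen 4; cut C-L4-D3COEFF,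
lead (R-8) S14747; the design question S14918, option (A), typer-2 g4's `Common/LocalCoordinatesConj` p700125
S14937).  Target tree path `lean/Summits/Ventures/HodgeRepro/Tier4/Line4/D3CoeffConj.lean`.  On `Line4/D3Coeff` (p699431)
and `Line4/D3CoeffUnitary` (p700064) at the SECOND row plane `W' := ofLinesRow q (a 1) (a 3) (−1)`, transported to the
seesaw plane `W := (mixedRow q (a 0) (a 2)).withTransportedTorus g g' …` along typer-2's `conjTo : GA W → GA W'`
(`x ↦ g′ x g`, a continuous group homomorphism; `conjTo_mem_torusT_of_mem_torusT'`: the transported torus `T′` of `W`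
lands in the block-diagonal torus of `W'`; `weightAt'_eq_weightAt_conjTo`: the transported weights are the weights at
`W'`); no printed input.

THE OBJECT.  **`D3coeff' x := D3coeff q (a 1) (a 3) (−1) w (conjTo x) = (locEntry' x 0 0)⁻¹ ^ 3`** — the lowest-weight
coefficient `ᾱ′^{−3}` of `D₃` read in the `T′`-ADAPTED coordinates of the seesaw plane (S14898 (2): `D3coeff` itself is
`T`-equivariant, not `T′`-equivariant; the `(d)`-plate consumers of LINE L4 read the SECOND torus).

WHAT IS PROVED (kernel; by name from p699431 / p700064 at `W'` and `conjTo`):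
* `D3coeff'_one`; `continuous_D3coeff'`, `norm_D3coeff'_le_one` (the second row's sign clauses `0 < (a 1)_w`,
  `(−a 3)_w < 0` at `w`: the `w`-block of `T′` is in `U(1,1)`); `D3coeff'_inv` (`D3coeff' x⁻¹ = conj (D3coeff' x)`);
* **THE `T′`-EQUIVARIANCE LAWS** `D3coeff'_torus'_mul` / `D3coeff'_mul_torus'`: for `κ ∈ T′(𝔸)`,
  `D3coeff' (κ x) = (weightAt' W q w g g' 0 κ)⁻¹ ^ 3 · D3coeff' x` and the right twin — weight `(−3, 0)` for the
  transported weights `weightAt'`;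
* `weightAt'_inv_of_mem_torusT'`, `conj_weightAt'_of_mem_torusT'` — on `T′` the transported weight is a unitary character
  (`u(κ⁻¹) = u(κ)⁻¹`, `conj u(κ) = u(κ)⁻¹`; RowWeights' `weightAt_mul`, `norm_weightAt_eq_one` at `W'`);
* **`cj_D3coeff'_inv_mul`** — THE `equiv` FIELD OF `IsArchCoeff` AT `w`: for `κ ∈ localTorusAt' W w` and every `y`,
  `RTF.cj D3coeff' (κ⁻¹ y) = weightAt' W q w g g' 0 κ ^ (−(3 : ℤ)) · weightAt' W q w g g' 1 κ ^ (−(0 : ℤ)) · RTF.cj D3coeff' y`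
  — plan-4's clause (ii) verbatim with `(eP′ w, eM′ w) = (3, 0)` (the `_he = ±3` of L4-MATH §15.1, now a theorem: the
  coefficient pins the second torus' weight at `w₀` to `(3, 0)` on the conjugate).

* `D3coeff'_mul_of_mem_localTorusAt'_ne` — the local tori of the OTHER places `w' ≠ w` act TRIVIALLY (`D3coeff'` reads
  the `w`-block only; `IsAtPlace` is preserved by `conjTo`): the `equiv` clause at `w' ≠ w` holds with weights `(0, 0)`
  — the bump factors of the other places, the line's data, carry any other weights.

NOT here: the `G_∞`-integrability
(print), the operator Schur vanishing (print), the `w₀` Fourier coefficient (displayed).  Nothing here says anything about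
the status of the Hodge conjecture for CM abelian varieties, which is NOT proved (HC_CM is NOT proved by anyone in this
repository).
-/

set_option autoImplicit false

noncomputable section

namespace Summit.Ventures.HodgeRepro.Tier4.Line4

open Summit.Ventures.HodgeRepro.Tier4.Common Summit.Ventures.HodgeRepro.Tier4.Line1 NumberField Matrix

open scoped ComplexConjugate

section D3Conj

variable {k : Type} [Field k] [NumberField k] (q : QuadData k) (a : Fin 4 → k)
  (g g' : Matrix (Fin 4) (Fin 4) k) (hgg' : g * g' = 1) (hg'g : g' * g = 1)
  (hgΩ : g * (PlaneData.mixedRow q (a 0) (a 2)).Ω = (PlaneData.mixedRow q (a 0) (a 2)).Ω * g)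
  (lam : k) (hlam : lam ≠ 0)
  (hiso : g * (PlaneData.mixedRow q (a 1) (a 3)).B * gᵀ = lam • (PlaneData.mixedRow q (a 0) (a 2)).B)
  (w : InfinitePlace k)

/-- **the `T′`-adapted weight-3 coefficient of the seesaw plane at `w`**: `D3coeff` of the second row plane at the
conjugate `g′ x g` — `(locEntry' x 0 0)⁻¹ ^ 3`, the lowest-weight coefficient of `D₃` in the coordinates adapted to the
transported torus `T′`. -/
def D3coeff' (x : GA ((PlaneData.mixedRow q (a 0) (a 2)).withTransportedTorus g g' hgg' hg'g hgΩ)) : ℂ :=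
  D3coeff q (a 1) (a 3) (-1) w (conjTo q a g g' hgg' hg'g hgΩ lam hiso x)

/-- `D3coeff'` in the `T′`-adapted coordinates (`rfl`). -/
theorem D3coeff'_eq (x : GA ((PlaneData.mixedRow q (a 0) (a 2)).withTransportedTorus g g' hgg' hg'g hgΩ)) :
    D3coeff' q a g g' hgg' hg'g hgΩ lam hiso w x =
      (locEntry' q a g g' hgg' hg'g hgΩ lam hiso w x 0 0)⁻¹ ^ 3 := rfl

/-- `D3coeff' 1 = 1`. -/
theorem D3coeff'_one : D3coeff' q a g g' hgg' hg'g hgΩ lam hiso w 1 = 1 := by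
  unfold D3coeff'
  rw [conjTo_one]
  exact D3coeff_one q (a 1) (a 3) (-1) w

/-- continuity (the second row's sign clauses at `w`: the `w`-block of `T′` is in `U(1,1)`, `α′ ≠ 0`). -/
theorem continuous_D3coeff' (hw : w.IsReal) (hcm : IsCMAt q w)
    (ha1 : 0 < (adToC w (algebraMap k (Ad k) (a 1))).re) (ha3 : (adToC w (algebraMap k (Ad k) (-1 * a 3))).re < 0) :
    Continuous (D3coeff' q a g g' hgg' hg'g hgΩ lam hiso w) :=
  (continuous_D3coeff q (a 1) (a 3) (-1) w hw hcm (disc_ne_zero_of_isCMAt q w hw hcm) ha1 ha3).comp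
    (continuous_conjTo q a g g' hgg' hg'g hgΩ lam hiso)

/-- the bound `‖D3coeff' x‖ ≤ 1`. -/
theorem norm_D3coeff'_le_one (hw : w.IsReal) (hcm : IsCMAt q w)
    (ha1 : 0 < (adToC w (algebraMap k (Ad k) (a 1))).re) (ha3 : (adToC w (algebraMap k (Ad k) (-1 * a 3))).re < 0)
    (x : GA ((PlaneData.mixedRow q (a 0) (a 2)).withTransportedTorus g g' hgg' hg'g hgΩ)) :
    ‖D3coeff' q a g g' hgg' hg'g hgΩ lam hiso w x‖ ≤ 1 :=
  norm_D3coeff_le_one q (a 1) (a 3) (-1) w hw hcm (disc_ne_zero_of_isCMAt q w hw hcm) ha1 ha3 _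

/-- `D3coeff' x⁻¹ = conj (D3coeff' x)`. -/
theorem D3coeff'_inv (hw : w.IsReal) (hcm : IsCMAt q w) (ha1 : adToC w (algebraMap k (Ad k) (a 1)) ≠ 0)
    (x : GA ((PlaneData.mixedRow q (a 0) (a 2)).withTransportedTorus g g' hgg' hg'g hgΩ)) :
    D3coeff' q a g g' hgg' hg'g hgΩ lam hiso w x⁻¹ = conj (D3coeff' q a g g' hgg' hg'g hgΩ lam hiso w x) := by
  have hinv : conjTo q a g g' hgg' hg'g hgΩ lam hiso x⁻¹ = (conjTo q a g g' hgg' hg'g hgΩ lam hiso x)⁻¹ :=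
    map_inv (conjToHom q a g g' hgg' hg'g hgΩ lam hiso) x
  unfold D3coeff'
  rw [hinv]
  exact D3coeff_inv q (a 1) (a 3) (-1) w hw hcm (disc_ne_zero_of_isCMAt q w hw hcm) ha1 _

include hlam in
/-- **THE `T′`-EQUIVARIANCE LAW (left)**: `D3coeff' (κ x) = (weightAt' … 0 κ)⁻¹ ^ 3 · D3coeff' x` for `κ ∈ T′(𝔸)`. -/
theorem D3coeff'_torus'_mul (hw : w.IsReal) (hcm : IsCMAt q w) (ha1 : a 1 ≠ 0) (ha3 : a 3 ≠ 0)
    (x κ : GA ((PlaneData.mixedRow q (a 0) (a 2)).withTransportedTorus g g' hgg' hg'g hgΩ))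
    (hκ : κ ∈ torusT' ((PlaneData.mixedRow q (a 0) (a 2)).withTransportedTorus g g' hgg' hg'g hgΩ)) :
    D3coeff' q a g g' hgg' hg'g hgΩ lam hiso w (κ * x) =
      (weightAt' ((PlaneData.mixedRow q (a 0) (a 2)).withTransportedTorus g g' hgg' hg'g hgΩ) q w g g' 0 κ)⁻¹ ^ 3 *
        D3coeff' q a g g' hgg' hg'g hgΩ lam hiso w x := by
  rw [weightAt'_eq_weightAt_conjTo q a g g' hgg' hg'g hgΩ lam hiso]
  unfold D3coeff'
  rw [conjTo_mul]
  exact D3coeff_torus_mul q (a 1) (a 3) (-1) w hw hcm ha1 ha3 (by norm_num) _ _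
    (conjTo_mem_torusT_of_mem_torusT' q a g g' hgg' hg'g hgΩ lam hlam hiso hκ)

include hlam in
/-- **THE `T′`-EQUIVARIANCE LAW (right)**: `D3coeff' (x κ) = (weightAt' … 0 κ)⁻¹ ^ 3 · D3coeff' x` for `κ ∈ T′(𝔸)`. -/
theorem D3coeff'_mul_torus' (hw : w.IsReal) (hcm : IsCMAt q w) (ha1 : a 1 ≠ 0) (ha3 : a 3 ≠ 0)
    (x κ : GA ((PlaneData.mixedRow q (a 0) (a 2)).withTransportedTorus g g' hgg' hg'g hgΩ))
    (hκ : κ ∈ torusT' ((PlaneData.mixedRow q (a 0) (a 2)).withTransportedTorus g g' hgg' hg'g hgΩ)) :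
    D3coeff' q a g g' hgg' hg'g hgΩ lam hiso w (x * κ) =
      (weightAt' ((PlaneData.mixedRow q (a 0) (a 2)).withTransportedTorus g g' hgg' hg'g hgΩ) q w g g' 0 κ)⁻¹ ^ 3 *
        D3coeff' q a g g' hgg' hg'g hgΩ lam hiso w x := by
  rw [weightAt'_eq_weightAt_conjTo q a g g' hgg' hg'g hgΩ lam hiso]
  unfold D3coeff'
  rw [conjTo_mul]
  exact D3coeff_mul_torus q (a 1) (a 3) (-1) w hw hcm ha1 ha3 (by norm_num) _ _
    (conjTo_mem_torusT_of_mem_torusT' q a g g' hgg' hg'g hgΩ lam hlam hiso hκ)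

include hlam hiso in
/-- on `T′` the transported weight is multiplicative: `u(κ⁻¹) = u(κ)⁻¹` (RowWeights' `weightAt_mul` at the second row
plane through `conjTo`). -/
theorem weightAt'_inv_of_mem_torusT' (hw : w.IsReal) (hcm : IsCMAt q w) (ha1 : a 1 ≠ 0) (ha3 : a 3 ≠ 0) (j : Fin 2)
    {κ : GA ((PlaneData.mixedRow q (a 0) (a 2)).withTransportedTorus g g' hgg' hg'g hgΩ)}
    (hκ : κ ∈ torusT' ((PlaneData.mixedRow q (a 0) (a 2)).withTransportedTorus g g' hgg' hg'g hgΩ)) :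
    weightAt' ((PlaneData.mixedRow q (a 0) (a 2)).withTransportedTorus g g' hgg' hg'g hgΩ) q w g g' j κ⁻¹ =
      (weightAt' ((PlaneData.mixedRow q (a 0) (a 2)).withTransportedTorus g g' hgg' hg'g hgΩ) q w g g' j κ)⁻¹ := by
  rw [weightAt'_eq_weightAt_conjTo q a g g' hgg' hg'g hgΩ lam hiso,
    weightAt'_eq_weightAt_conjTo q a g g' hgg' hg'g hgΩ lam hiso]
  have hinv : conjTo q a g g' hgg' hg'g hgΩ lam hiso κ⁻¹ = (conjTo q a g g' hgg' hg'g hgΩ lam hiso κ)⁻¹ :=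
    map_inv (conjToHom q a g g' hgg' hg'g hgΩ lam hiso) κ
  rw [hinv]
  have hmem := conjTo_mem_torusT_of_mem_torusT' q a g g' hgg' hg'g hgΩ lam hlam hiso hκ
  have hmul := weightAt_mul q (a 1) (a 3) (-1) w ha1 ha3 (by norm_num) hw hcm j hmem
    ((torusT (PlaneData.ofLinesRow q (a 1) (a 3) (-1))).inv_mem hmem)
  rw [mul_inv_cancel, weightAt_one] at hmul
  exact (eq_inv_of_mul_eq_one_right hmul.symm)

include hlam hiso in
/-- on `T′` the transported weight is unitary: `conj u(κ) = u(κ)⁻¹` (`‖u(κ)‖ = 1`, RowWeights' `norm_weightAt_eq_one`). -/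
theorem conj_weightAt'_of_mem_torusT' (hw : w.IsReal) (hcm : IsCMAt q w) (ha1 : a 1 ≠ 0) (ha3 : a 3 ≠ 0) (j : Fin 2)
    {κ : GA ((PlaneData.mixedRow q (a 0) (a 2)).withTransportedTorus g g' hgg' hg'g hgΩ)}
    (hκ : κ ∈ torusT' ((PlaneData.mixedRow q (a 0) (a 2)).withTransportedTorus g g' hgg' hg'g hgΩ)) :
    conj (weightAt' ((PlaneData.mixedRow q (a 0) (a 2)).withTransportedTorus g g' hgg' hg'g hgΩ) q w g g' j κ) =
      (weightAt' ((PlaneData.mixedRow q (a 0) (a 2)).withTransportedTorus g g' hgg' hg'g hgΩ) q w g g' j κ)⁻¹ := by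
  rw [weightAt'_eq_weightAt_conjTo q a g g' hgg' hg'g hgΩ lam hiso]
  have hnorm := norm_weightAt_eq_one q (a 1) (a 3) (-1) w ha1 ha3 (by norm_num) hw hcm j
    (conjTo_mem_torusT_of_mem_torusT' q a g g' hgg' hg'g hgΩ lam hlam hiso hκ)
  rw [Complex.inv_def, Complex.normSq_eq_norm_sq, hnorm, one_pow, inv_one, Complex.ofReal_one, mul_one]

include hlam in
/-- **THE `equiv` FIELD OF `IsArchCoeff` (7′) AT `w`, with `(eP′ w, eM′ w) = (3, 0)`**: for `κ ∈ T′_w` and every `y`,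
`RTF.cj D3coeff' (κ⁻¹ y) = weightAt' … 0 κ ^ (−3) · weightAt' … 1 κ ^ (−0) · RTF.cj D3coeff' y` — the left
`(T′_w, (−3, 0))`-equivariance of the conjugate coefficient (`cj (u⁻¹ ^ 3 · z) = conj u ^ 3 · cj z = u^{−3} · cj z` on the
unitary torus weight). -/
theorem cj_D3coeff'_inv_mul (hw : w.IsReal) (hcm : IsCMAt q w) (ha1 : a 1 ≠ 0) (ha3 : a 3 ≠ 0)
    {κ : GA ((PlaneData.mixedRow q (a 0) (a 2)).withTransportedTorus g g' hgg' hg'g hgΩ)}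
    (hκ : κ ∈ localTorusAt' ((PlaneData.mixedRow q (a 0) (a 2)).withTransportedTorus g g' hgg' hg'g hgΩ) w)
    (y : GA ((PlaneData.mixedRow q (a 0) (a 2)).withTransportedTorus g g' hgg' hg'g hgΩ)) :
    RTF.cj (D3coeff' q a g g' hgg' hg'g hgΩ lam hiso w) (κ⁻¹ * y) =
      weightAt' ((PlaneData.mixedRow q (a 0) (a 2)).withTransportedTorus g g' hgg' hg'g hgΩ) q w g g' 0 κ ^
          (-(3 : ℤ)) *
        weightAt' ((PlaneData.mixedRow q (a 0) (a 2)).withTransportedTorus g g' hgg' hg'g hgΩ) q w g g' 1 κ ^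
          (-(0 : ℤ)) *
        RTF.cj (D3coeff' q a g g' hgg' hg'g hgΩ lam hiso w) y := by
  have hκT : κ ∈ torusT' ((PlaneData.mixedRow q (a 0) (a 2)).withTransportedTorus g g' hgg' hg'g hgΩ) := hκ.1
  have hκT' : κ⁻¹ ∈ torusT' ((PlaneData.mixedRow q (a 0) (a 2)).withTransportedTorus g g' hgg' hg'g hgΩ) :=
    (torusT' _).inv_mem hκT
  unfold RTF.cj
  rw [D3coeff'_torus'_mul q a g g' hgg' hg'g hgΩ lam hlam hiso w hw hcm ha1 ha3 y κ⁻¹ hκT',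
    weightAt'_inv_of_mem_torusT' q a g g' hgg' hg'g hgΩ lam hlam hiso w hw hcm ha1 ha3 0 hκT, inv_inv, map_mul,
    map_pow, conj_weightAt'_of_mem_torusT' q a g g' hgg' hg'g hgΩ lam hlam hiso w hw hcm ha1 ha3 0 hκT,
    neg_zero, zpow_zero, mul_one, _root_.zpow_neg, zpow_ofNat, inv_pow]


include hlam in
/-- **the local tori of the OTHER places act trivially**: for `κ ∈ T′_{w'}` with `w' ≠ w`, the `w`-block of `conjTo κ`
is the identity (`IsAtPlace` is preserved by the conjugation, `isAtPlace_conj`), so `D3coeff' (κ x) = D3coeff' x` —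
the `equiv` clause of `IsArchCoeff` at the places `w' ≠ w` holds with the weights `(0, 0)`. -/
theorem D3coeff'_mul_of_mem_localTorusAt'_ne (hw : w.IsReal) (hcm : IsCMAt q w) {w' : InfinitePlace k} (hne : w' ≠ w)
    {κ : GA ((PlaneData.mixedRow q (a 0) (a 2)).withTransportedTorus g g' hgg' hg'g hgΩ)}
    (hκ : κ ∈ localTorusAt' ((PlaneData.mixedRow q (a 0) (a 2)).withTransportedTorus g g' hgg' hg'g hgΩ) w')
    (x : GA ((PlaneData.mixedRow q (a 0) (a 2)).withTransportedTorus g g' hgg' hg'g hgΩ)) :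
    D3coeff' q a g g' hgg' hg'g hgΩ lam hiso w (κ * x) = D3coeff' q a g g' hgg' hg'g hgΩ lam hiso w x := by
  have hat : IsAtPlace (PlaneData.ofLinesRow q (a 1) (a 3) (-1)) w' (conjTo q a g g' hgg' hg'g hgΩ lam hiso κ) :=
    (conjTo_mem_localTorusAt_of_mem_localTorusAt' q a g g' hgg' hg'g hgΩ lam hlam hiso w' hκ).2
  have hcomp : GA.infiniteComponent (PlaneData.ofLinesRow q (a 1) (a 3) (-1)) w
      (conjTo q a g g' hgg' hg'g hgΩ lam hiso κ) = 1 := hat.2 w hne.symm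
  have hone : locMat q (a 1) (a 3) (-1) w (conjTo q a g g' hgg' hg'g hgΩ lam hiso κ) = 1 := by
    funext I J
    rw [locMat_apply, locEntry, entryAt, entryAt, hcomp]
    fin_cases I <;> fin_cases J <;> simp [lineBase, lineOmega]
  unfold D3coeff'
  rw [conjTo_mul]
  unfold D3coeff
  have hmul := congrFun (congrFun (locMat_mul q (a 1) (a 3) (-1) w hw hcm
    (conjTo q a g g' hgg' hg'g hgΩ lam hiso κ) (conjTo q a g g' hgg' hg'g hgΩ lam hiso x)) 0) 0
  rw [hone, one_mul, locMat_apply, locMat_apply] at hmul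
  rw [hmul]

end D3Conj

end Summit.Ventures.HodgeRepro.Tier4.Line4

end
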